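import Mathlib
import HarnessLib
import Summits.BirchSwinnertonDyer.BirchSwinnertonDyer.Theorems.GoldfeldGoodTwistsAllTwistsX049
import Summits.BirchSwinnertonDyer.Rank1Residual.P2.RouteTargetsAtTwo
import Summits.BirchSwinnertonDyer.BirchSwinnertonDyer.Theses.GoldfeldAllTwistsTwoConverse

/-! # BC3 birth skeleton — crux K12₂′ `RankOneTwoConverseCMSevenAtAnyTwo` of route `GoldfeldAllTwistsTwoConverse`
(planner bsd-goldfeld-plan g5, 2026-08-25; item stmt-BirchSwinnertonDyer-19349)

REGIME SPLIT at the prime `2` (good reduction = the printed theorem's cell; not-good = additive = the open cell)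
after a model/isogeny reduction, with the composition PROVED:
`RankOneTwoConverseCMSevenAtAnyTwo_of : Sig.stub_modelReduction → Sig.stub_twoConverse_good →
Sig.stub_twoConverse_additive → RankOneTwoConverseCMSevenAtAnyTwo` (the crux BY NAME, imported from the
gate-written `Theses/GoldfeldAllTwistsTwoConverse.lean`). The `Sig.*` legend is the stub signatures verbatim;
sorries ONLY inside `stub_*`. -/

set_option linter.dupNamespace false
set_option autoImplicit false

namespace Summit.BirchSwinnertonDyer.BirchSwinnertonDyer.Cruxes.RankOneTwoConverseCMSevenAtAnyTwo.Birth

open Summit.BirchSwinnertonDyer.BirchSwinnertonDyer.Theses.GoldfeldAllTwistsTwoConverse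

open Literature.NumberTheory.EllipticCurves Literature.NumberTheory.EllipticCurves.Rank1Residual

/-! ## Legend: the stub statements as named propositions (verbatim the registered signatures) -/

/-- Statement of `stub_modelReduction`. -/
def Sig.stub_modelReduction : Prop :=
  ∀ (W : WeierstrassCurve ℚ) [W.IsElliptic], (W.j = -3375 ∨ W.j = 16581375) → W.selmerCorank 2 = 1 →
    ∃ (W' : WeierstrassCurve ℚ) (_ : W'.IsElliptic) (_ : W'.IsGloballyMinimal),
      W'.j = -3375 ∧ W'.selmerCorank 2 = 1 ∧ W'.analyticRank = W.analyticRank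

/-- Statement of `stub_twoConverse_good`. -/
def Sig.stub_twoConverse_good : Prop :=
  ∀ (W : WeierstrassCurve ℚ) [W.IsElliptic] [W.IsGloballyMinimal], W.j = -3375 →
    W.HasGoodReductionAtPrime 2 → W.selmerCorank 2 = 1 → W.analyticRank = 1

/-- Statement of `stub_twoConverse_additive`. -/
def Sig.stub_twoConverse_additive : Prop :=
  ∀ (W : WeierstrassCurve ℚ) [W.IsElliptic] [W.IsGloballyMinimal], W.j = -3375 →
    ¬ W.HasGoodReductionAtPrime 2 → W.selmerCorank 2 = 1 → W.analyticRank = 1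

/-! ## Registered stubs (`sorry` only here) -/

/-- STUB (M). Model + isogeny reduction: a curve with `j ∈ {−3375, 16581375}` and `2^∞`-Selmer corank `1`
has a GLOBALLY MINIMAL companion with `j = −3375`, the same `2^∞`-Selmer corank and the same analytic
rank (minimal model: `C • W' = W`, invariance of `j`, `Sel_{2^∞}`-corank and `ord_{s=1} L` under `≃`;
for `j = 16581375` pass to the `2`-ISOGENOUS curve with `j = −3375` — CM by `ℤ[√−7]` vs `𝒪_K`, e.g.
`49a2 → 49a1` — corank and analytic rank are isogeny invariants: tree
`selmerCorankTwoInfty_quadraticTwist_intCast_eq_of_isIsogenous`, `L`-function isogeny invariance). -/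
theorem stub_modelReduction :
    ∀ (W : WeierstrassCurve ℚ) [W.IsElliptic], (W.j = -3375 ∨ W.j = 16581375) → W.selmerCorank 2 = 1 →
      ∃ (W' : WeierstrassCurve ℚ) (_ : W'.IsElliptic) (_ : W'.IsGloballyMinimal),
        W'.j = -3375 ∧ W'.selmerCorank 2 = 1 ∧ W'.analyticRank = W.analyticRank := by
  sorry

/-- STUB (L; in print). The GOOD-reduction cell: a minimal `W` with `j = −3375` and good reduction at `2`
(then `2` split in `K = ℚ(√−7)` ⟹ good ORDINARY, `a_2` odd) with `corank Sel_{2^∞} = 1` has analytic rank `1`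
— Burungale–Castella–Skinner–Tian 2022 Thm A at `p = 2` (tree fact
`BurungaleCastellaSkinnerTian2022.thmA_analyticRank_eq_one_of_selmerCorank_eq_one`, hypotheses: `HasCM`
(`hasCM_of_j_eq_neg3375`), `DifferentExactlyDividesHeckeConductor` (the class lemma of file 3 for the
`d ≡ 1 (mod 4)` twists of `49a1`), good ordinary). Closable from the named fact + class bookkeeping. -/
theorem stub_twoConverse_good :
    ∀ (W : WeierstrassCurve ℚ) [W.IsElliptic] [W.IsGloballyMinimal], W.j = -3375 →
      W.HasGoodReductionAtPrime 2 → W.selmerCorank 2 = 1 → W.analyticRank = 1 := by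
  sorry

/-- STUB (XL; the OPEN content, "K12₂″"). The ADDITIVE cell: a minimal `W` with `j = −3375` and bad
(hence additive, potentially good ordinary — CM curves have no multiplicative primes) reduction at `2`,
i.e. `W ≅ 49a1^{(d)}` with `d ≢ 1 (mod 4)`, `N = 784 d'²` or `3136 d'²`: `corank Sel_{2^∞} = 1 ⟹ ord_{s=1} L = 1`.
Burungale–Castella–Skinner–Tian Rem. D's "potentially good ordinary" case; Keller–Yin Thm 0.1.2's shape at
the excluded prime `p = 2` (`W[2](ℚ) = ℤ/2`: Eisenstein at `2`). Inputs in print at `p = 2` for `ℚ(√−7)`: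
`2`-adic anticyclotomic / two-variable measures and GL₁ main conjectures (Choi–Coates, Choi–Kezuka–Li,
Kezuka, Kezuka–Li), `2`-adic Gross–Zagier for CM potentially good ordinary (LTYZ Thm 8.2 ← Disegni). -/
theorem stub_twoConverse_additive :
    ∀ (W : WeierstrassCurve ℚ) [W.IsElliptic] [W.IsGloballyMinimal], W.j = -3375 →
      ¬ W.HasGoodReductionAtPrime 2 → W.selmerCorank 2 = 1 → W.analyticRank = 1 := by
  sorry

/-! ## Composition (PROVED): model/isogeny reduction, then the dichotomy good / not-good at `2` -/

theorem RankOneTwoConverseCMSevenAtAnyTwo_of :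
    Sig.stub_modelReduction → Sig.stub_twoConverse_good → Sig.stub_twoConverse_additive →
      RankOneTwoConverseCMSevenAtAnyTwo := by
  intro h₁ h₂ h₃ W _ hj hsel
  obtain ⟨W', _, _, hj', hsel', har⟩ := h₁ W hj hsel
  rw [← har]
  by_cases hg : W'.HasGoodReductionAtPrime 2
  · exact h₂ W' hj' hg hsel'
  · exact h₃ W' hj' hg hsel'

/-- The crux by name, closed modulo the three registered stubs (checks that the `Sig.*` legend is the stub
signatures verbatim). -/
theorem rankOneTwoConverseCMSevenAtAnyTwo_of_stubs : RankOneTwoConverseCMSevenAtAnyTwo :=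
  RankOneTwoConverseCMSevenAtAnyTwo_of
    (fun W _ hj hsel => stub_modelReduction W hj hsel)
    (fun W _ _ hj hg hsel => stub_twoConverse_good W hj hg hsel)
    (fun W _ _ hj hg hsel => stub_twoConverse_additive W hj hg hsel)

end Summit.BirchSwinnertonDyer.BirchSwinnertonDyer.Cruxes.RankOneTwoConverseCMSevenAtAnyTwo.Birth
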